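import Mathlib
import Summits.ValiantsHypothesis.ValiantsHypothesis.Theorems.GrenetZeonPolySizeQPAlgebraCornerThree
import HarnessLib

/-!
# Crux `GrenetZeon.PolySizeQPAlgebra` (stmt-ValiantsHypothesis-8064), line `vbp-slice-dealg` —
# the point `(n, 4)`: a good `5`-space leaves exactly ONE type, the local algebra `ℂ[x,y]/(x², y²)`

Continuation of `…CornerThree` one step up the `s`-axis of the `c = 1` box.  A local Frobenius algebra of
dimension `4` is either CURVILINEAR (`ℂ[ε]/ε⁴`: some `e ∈ 𝔪` has `e³ ≠ 0`, `exists_basis_pow_four_of_cube_ne_zero`)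
or has `𝔪³ = 0` (`≅ ℂ[x,y]/(x²,y²)`).  Every decomposition type of an `(n, 4)`-witness of `per_n` other than a
SINGLE piece of the latter kind consists of curvilinear pieces (dimensions `≤ 3`, or `4` with a cube), hence is a
sum of jet forms with `Σ r_u ≤ 4` and is excluded by a good `5`-space with threshold `8n`
(`perPoly_ne_sum_linear_jets_of_goodSpace`).  So:

* `hasAlgDetRepr_four_residual_of_goodFiveSpace` — **given a good `5`-space with threshold `8n` at `n ≥ 1`,
  every `(n, 4)`-representation of `per_n` comes from a SINGLE local Frobenius piece `(R, φ, λ, A)` of dimension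
  exactly `4` with `e³ = 0` for all `e ∈ ker φ`** (linear entries, `λ` nondegenerate) — the type on which the
  jet engine is known to fail (hand census: the Hessian of `λ(det A)` has full rank at the relevant points).

HONEST FRAMING: a conditional classification of the residual case; no stub of the line is closed; VP ≠ VNP is
not moved.

References: T. Mignon, N. Ressayre, IMRN 2004:79 [MignonRessayre2004]; P. Hrubeš, A. Yehudayoff, Theory of
Computing 7 (2011), §2 [HrubesYehudayoff2011].
-/

noncomputable section

open MvPolynomial Matrix
open Literature.Computability.AlgebraicComplexity

-- single-conjunct layout `Summits/ValiantsHypothesis/ValiantsHypothesis`: duplicated namespace by design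
set_option linter.dupNamespace false

namespace Summit.ValiantsHypothesis.ValiantsHypothesis.Theorems.GrenetZeonPolySizeQPAlgebra

section Curvilinear4

variable {R : Type*} [CommRing R] [Algebra ℂ R]

omit [Algebra ℂ R] in
/-- If `x = x · y` with `y` nilpotent then `x = 0`. [folklore] -/
theorem eq_zero_of_eq_mul_of_pow_eq_zero {x y : R} {s : ℕ} (h : x = x * y) (hs : y ^ s = 0) : x = 0 := by
  have hk : ∀ k : ℕ, x = x * y ^ k := by
    intro k
    induction k with
    | zero => rw [pow_zero, mul_one]
    | succ k ih =>
        calc x = x * y ^ k := ih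
          _ = x * y * y ^ k := by rw [← h]
          _ = x * y ^ (k + 1) := by rw [pow_succ']; ring
  rw [hk s, hs, mul_zero]

/-- **Dimension `4` with a non-zero cube is curvilinear: `R = ℂ[ε]/ε⁴`.**  If `e ∈ ker φ` (nilpotent kernel) has
`e³ ≠ 0` and `dim R = 4`, then `(1, e, e², e³)` is a basis and `e⁴ = 0`. [folklore] -/
theorem exists_basis_pow_four_of_cube_ne_zero (φ : R →ₐ[ℂ] ℂ) {s : ℕ}
    (hker : RingHom.ker (φ : R →+* ℂ) ^ s = ⊥) (h4 : Module.finrank ℂ R = 4) {e : R} (hφe : φ e = 0)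
    (he3 : e * e * e ≠ 0) :
    e ^ 4 = 0 ∧ ∃ b : Module.Basis (Fin 4) ℂ R, ∀ j, b j = e ^ (j : ℕ) := by
  have hnil : e ^ s = 0 := pow_eq_zero_of_ker_pow_eq_bot φ hker hφe
  have he2 : e * e ≠ 0 := fun h => he3 (by rw [h, zero_mul])
  have he0 : e ≠ 0 := fun h => he2 (by rw [h, zero_mul])
  -- nilpotency of scalar multiples of `e` times anything in `e`
  have hnilmul : ∀ u : R, (e * u) ^ s = 0 := fun u => by rw [mul_pow, hnil, zero_mul]
  -- `(1, e, e², e³)` is linearly independent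
  have hli : LinearIndependent ℂ (![(1 : R), e, e * e, e * e * e] : Fin 4 → R) := by
    rw [Fintype.linearIndependent_iff]
    intro g hg
    simp only [Fin.sum_univ_four, Matrix.cons_val_zero, Matrix.cons_val_one, Matrix.cons_val] at hg
    have hg0 : g 0 = 0 := by
      have := congrArg φ hg
      simpa [hφe] using this
    rw [hg0, zero_smul, zero_add] at hg
    -- `β e + γ e² + δ e³ = 0`
    have hg1 : g 1 = 0 := by
      by_contra hβ
      have he : e = e * (e * algebraMap ℂ R (-(g 2 / g 1)) + e * e * algebraMap ℂ R (-(g 3 / g 1))) := by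
        have h2 : g 1 • e = -(g 2 • (e * e)) - g 3 • (e * e * e) := by
          rw [eq_sub_iff_add_eq, eq_neg_iff_add_eq_zero]; rw [← hg]; abel
        calc e = (g 1)⁻¹ • (g 1 • e) := by rw [smul_smul, inv_mul_cancel₀ hβ, one_smul]
          _ = (-(g 2 / g 1)) • (e * e) + (-(g 3 / g 1)) • (e * e * e) := by
              rw [h2, smul_sub, smul_neg, smul_smul, smul_smul, ← neg_smul, div_eq_inv_mul,
                div_eq_inv_mul, sub_eq_add_neg, ← neg_smul]
          _ = e * (e * algebraMap ℂ R (-(g 2 / g 1)) + e * e * algebraMap ℂ R (-(g 3 / g 1))) := by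
              rw [Algebra.smul_def, Algebra.smul_def]; ring
      have hy : (e * algebraMap ℂ R (-(g 2 / g 1)) + e * e * algebraMap ℂ R (-(g 3 / g 1))) ^ s = 0 := by
        have : e * algebraMap ℂ R (-(g 2 / g 1)) + e * e * algebraMap ℂ R (-(g 3 / g 1)) =
            e * (algebraMap ℂ R (-(g 2 / g 1)) + e * algebraMap ℂ R (-(g 3 / g 1))) := by ring
        rw [this]; exact hnilmul _
      exact he0 (eq_zero_of_eq_mul_of_pow_eq_zero he hy)
    rw [hg1, zero_smul, zero_add] at hg
    -- `γ e² + δ e³ = 0`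
    have hg2 : g 2 = 0 := by
      by_contra hγ
      have he : e * e = e * e * (e * algebraMap ℂ R (-(g 3 / g 2))) := by
        have h2 : g 2 • (e * e) = -(g 3 • (e * e * e)) := eq_neg_of_add_eq_zero_left hg
        calc e * e = (g 2)⁻¹ • (g 2 • (e * e)) := by rw [smul_smul, inv_mul_cancel₀ hγ, one_smul]
          _ = (-(g 3 / g 2)) • (e * e * e) := by rw [h2, smul_neg, smul_smul, ← neg_smul, div_eq_inv_mul]
          _ = e * e * (e * algebraMap ℂ R (-(g 3 / g 2))) := by rw [Algebra.smul_def]; ring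
      exact he2 (eq_zero_of_eq_mul_of_pow_eq_zero he (hnilmul _))
    rw [hg2, zero_smul, zero_add] at hg
    have hg3 : g 3 = 0 := (smul_eq_zero.1 hg).resolve_right he3
    intro i; fin_cases i <;> assumption
  set b := basisOfLinearIndependentOfCardEqFinrank hli (by simp [h4]) with hb
  have hbv : ∀ j, b j = (![(1 : R), e, e * e, e * e * e] : Fin 4 → R) j := fun j => by
    rw [hb, coe_basisOfLinearIndependentOfCardEqFinrank]
  -- `e⁴ = β e + γ e² + δ e³` forces `β = γ = δ = 0`
  have h4pow : e ^ 4 = 0 := by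
    have hrepr := b.sum_repr (e * e * e * e)
    rw [Fin.sum_univ_four, hbv, hbv, hbv, hbv] at hrepr
    simp only [Matrix.cons_val_zero, Matrix.cons_val_one, Matrix.cons_val] at hrepr
    have hα : b.repr (e * e * e * e) 0 = 0 := by
      have := congrArg φ hrepr
      simp only [map_add, map_smul, map_one, map_mul, hφe, smul_eq_mul, mul_zero, mul_one,
        add_zero] at this
      exact this
    rw [hα, zero_smul, zero_add] at hrepr
    set β := b.repr (e * e * e * e) 1
    set γ := b.repr (e * e * e * e) 2
    set δ := b.repr (e * e * e * e) 3
    have hβ : β = 0 := by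
      by_contra hβ
      have he : e = e * (e * (β⁻¹ • (e * e - algebraMap ℂ R γ - algebraMap ℂ R δ * e))) := by
        have h1 : β • e = e * e * e * e - γ • (e * e) - δ • (e * e * e) := by rw [← hrepr]; abel
        calc e = β⁻¹ • (β • e) := by rw [smul_smul, inv_mul_cancel₀ hβ, one_smul]
          _ = β⁻¹ • (e * e * e * e - γ • (e * e) - δ • (e * e * e)) := by rw [h1]
          _ = e * (e * (β⁻¹ • (e * e - algebraMap ℂ R γ - algebraMap ℂ R δ * e))) := by
              rw [mul_smul_comm, mul_smul_comm, Algebra.smul_def γ, Algebra.smul_def δ]; ring_nf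
      refine he0 (eq_zero_of_eq_mul_of_pow_eq_zero (s := s) he ?_)
      rw [mul_smul_comm, smul_pow, hnilmul, smul_zero]
    rw [hβ, zero_smul, zero_add] at hrepr
    have hγ : γ = 0 := by
      by_contra hγ
      have he : e * e = e * e * (e * (γ⁻¹ • (e - algebraMap ℂ R δ))) := by
        have h1 : γ • (e * e) = e * e * e * e - δ • (e * e * e) := by rw [← hrepr]; abel
        calc e * e = γ⁻¹ • (γ • (e * e)) := by rw [smul_smul, inv_mul_cancel₀ hγ, one_smul]
          _ = γ⁻¹ • (e * e * e * e - δ • (e * e * e)) := by rw [h1]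
          _ = e * e * (e * (γ⁻¹ • (e - algebraMap ℂ R δ))) := by
              rw [mul_smul_comm, mul_smul_comm, Algebra.smul_def δ]; ring_nf
      refine he2 (eq_zero_of_eq_mul_of_pow_eq_zero (s := s) he ?_)
      rw [mul_smul_comm, smul_pow, hnilmul, smul_zero]
    rw [hγ, zero_smul, zero_add] at hrepr
    rcases eq_zero_or_eq_zero_of_mul_eq_smul hrepr.symm hnil with hδ | he3'
    · calc e ^ 4 = e * e * e * e := by ring
        _ = δ • (e * e * e) := hrepr.symm
        _ = 0 := by rw [hδ, zero_smul]
    · exact absurd he3' he3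
  refine ⟨h4pow, b, fun j => ?_⟩
  fin_cases j
  · simpa using hbv 0
  · simpa using hbv 1
  · simpa [pow_two] using hbv 2
  · simpa [pow_succ, pow_two] using hbv 3

end Curvilinear4

/-! ### The residual type at `(n, 4)` -/

section CornerFour

/-- **The point `(n, 4)` under a good `5`-space: only the type `ℂ[x,y]/(x²,y²)` survives.**  If five linearly
independent `n × n` matrices span a space on which every non-zero zero of `per_n` has `rank Hess per_n > 8n`
(`n ≥ 1`), then every `(n, 4)`-representation of `per_n` is carried by a SINGLE local Frobenius piece of
dimension exactly `4` whose maximal ideal has vanishing cubes (`e³ = 0` for all `e ∈ ker φ`): `per_n = λ(det A)`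
coefficientwise with `A` an `n × n` matrix of linear forms over `R`, `λ` nondegenerate.  All other decomposition
types are sums of curvilinear jet forms with `Σ r_u ≤ 4` and are excluded by `perPoly_ne_sum_linear_jets_of_goodSpace`.
[cite: MignonRessayre2004, §2] -/
theorem hasAlgDetRepr_four_residual_of_goodFiveSpace {n : ℕ} (hn : 1 ≤ n)
    (hW : ∃ w : Fin 5 → (Fin n × Fin n → ℂ), LinearIndependent ℂ w ∧
      ∀ a : Fin 5 → ℂ, a ≠ 0 → eval (∑ i, a i • w i) (perPoly (Fin n) ℂ) = 0 →
        8 * n < (hess0 (transl (∑ i, a i • w i) (perPoly (Fin n) ℂ))).rank)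
    (h : HasAlgDetRepr (perPoly (Fin n) ℂ) n 4) :
    ∃ (R : Type) (_ : CommRing R) (_ : Algebra ℂ R) (_ : Module.Finite ℂ R) (φ : R →ₐ[ℂ] ℂ),
      Module.finrank ℂ R = 4 ∧ (∀ e : R, φ e = 0 → e ^ 3 = 0) ∧
        ∃ (l : R →ₗ[ℂ] ℂ) (A : Matrix (Fin n) (Fin n) (MvPolynomial (Fin n × Fin n) R)),
          (∀ a b, (A a b).IsHomogeneous 1) ∧
            (∀ d : (Fin n × Fin n) →₀ ℕ, l (coeff d A.det) = coeff d (perPoly (Fin n) ℂ)) ∧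
              ∀ r : R, (∀ x, l (x * r) = 0) → r = 0 := by
  classical
  obtain ⟨t, F, dim, -, hdim, hper, -, hloc⟩ := exists_homogeneous_local_frobenius_perPoly h
  -- either every piece is curvilinear (then contradiction), or some piece is the residual type
  by_cases hcurv : ∀ i : Fin t, ∃ (M : Matrix (Fin n) (Fin n) (Polynomial (MvPolynomial (Fin n × Fin n) ℂ)))
      (w : ℕ → ℂ), (∀ a b c, ((M a b).coeff c).IsHomogeneous 1) ∧
        F i = ∑ j ∈ Finset.range (dim i), C (w j) * M.det.coeff j
  · exfalso
    have hpos : ∀ i : Fin t, 1 ≤ dim i := by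
      intro i
      obtain ⟨R, _, _, _, φ, -, hdimR, -⟩ := hloc i
      have hnt : Nontrivial R := ⟨⟨1, 0, fun h10 => one_ne_zero ((map_one φ).symm.trans
        (by rw [h10, map_zero]))⟩⟩
      rw [← hdimR]; exact Module.finrank_pos
    choose M w hMlin hMF using hcurv
    have hsum : perPoly (Fin n) ℂ = ∑ u, ∑ j ∈ Finset.range (dim u), C (w u j) * (M u).det.coeff j := by
      rw [hper]; exact Finset.sum_congr rfl fun u _ => hMF u
    refine perPoly_ne_sum_linear_jets_of_goodSpace hW dim (fun _ => n) hpos (fun _ => hn)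
      (by omega) ?_ M hMlin w hsum
    rw [← Finset.sum_mul]
    calc (∑ u, dim u) * (2 * n) ≤ 4 * (2 * n) := Nat.mul_le_mul_right _ hdim
      _ = 8 * n := by ring
  · push Not at hcurv
    obtain ⟨i, hi⟩ := hcurv
    obtain ⟨R, _, _, _, φ, hker, hdimR, l, A, hA, hcoeff, hnondeg⟩ := hloc i
    have hnt : Nontrivial R := ⟨⟨1, 0, fun h10 => one_ne_zero ((map_one φ).symm.trans
      (by rw [h10, map_zero]))⟩⟩
    have h1 : 1 ≤ dim i := by rw [← hdimR]; exact Module.finrank_pos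
    have hle4 : dim i ≤ 4 :=
      (Finset.single_le_sum (fun j _ => Nat.zero_le (dim j)) (Finset.mem_univ i)).trans hdim
    -- a curvilinear structure would contradict `hi`
    have hnojet : ∀ (e : R), e ^ dim i = 0 → ∀ b : Module.Basis (Fin (dim i)) ℂ R,
        (∀ j, b j = e ^ (j : ℕ)) → False := by
      intro e he b hb
      obtain ⟨M, -, hMhom, hF⟩ := exists_jet_form_of_basis_pow e he b hb l A (F i) hcoeff
      exact hi M (fun j => l (e ^ j)) (fun a b' c => hMhom a b' c 1 (hA a b')) hF
    -- so `dim i = 4` and no element of `ker φ` has a non-zero cube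
    have hdim4 : dim i = 4 := by
      by_contra hne
      have h3 : dim i ≤ 3 := by omega
      obtain ⟨e, he, b, hb⟩ := exists_basis_pow_of_finrank_le_three φ hker l hnondeg hdimR h1 h3
      exact hnojet e he b hb
    have hR4 : Module.finrank ℂ R = 4 := by rw [hdimR, hdim4]
    have hcube : ∀ e : R, φ e = 0 → e ^ 3 = 0 := by
      intro e hφe
      by_contra h3
      have h3' : e * e * e ≠ 0 := by rwa [pow_succ, pow_two] at h3
      obtain ⟨he4, b, hb⟩ := exists_basis_pow_four_of_cube_ne_zero φ hker hR4 hφe h3'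
      obtain ⟨M, -, hMhom, hF⟩ := exists_jet_form_of_basis_pow e he4 b hb l A (F i) hcoeff
      have hi' := hi M (fun j => l (e ^ j)) (fun a b' c => hMhom a b' c 1 (hA a b'))
      rw [hdim4] at hi'
      exact hi' hF
    -- the single piece carries `per_n`: all other pieces are absent (`Σ dim ≤ 4`, every `dim ≥ 1`)
    have ht1 : ∀ j : Fin t, j = i := by
      intro j
      by_contra hji
      have hposj : 1 ≤ dim j := by
        obtain ⟨R', _, _, _, φ', -, hdimR', -⟩ := hloc j
        have hnt' : Nontrivial R' := ⟨⟨1, 0, fun h10 => one_ne_zero ((map_one φ').symm.trans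
          (by rw [h10, map_zero]))⟩⟩
        rw [← hdimR']; exact Module.finrank_pos
      have hsum2 : dim i + dim j ≤ ∑ u, dim u := by
        rw [← Finset.sum_pair (fun h => hji h.symm)]
        exact Finset.sum_le_sum_of_subset_of_nonneg (Finset.subset_univ _) fun _ _ _ => Nat.zero_le _
      omega
    have hFi : F i = perPoly (Fin n) ℂ := by
      rw [hper, Finset.sum_eq_single i (fun j _ hj => absurd (ht1 j) hj) (fun h => absurd (Finset.mem_univ i) h)]
    refine ⟨R, ‹_›, ‹_›, ‹_›, φ, hR4, hcube, l, A, hA, fun d => ?_, hnondeg⟩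
    rw [hcoeff d, hFi]

end CornerFour

end Summit.ValiantsHypothesis.ValiantsHypothesis.Theorems.GrenetZeonPolySizeQPAlgebra

end
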